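import Literature.MathematicalPhysics.QuantumFieldTheory.Balaban1983to89.B7AvgGaugeCovariance
import HarnessLib

/-!
# YM-DAG node N21 (= NE7c) — [Balaban1985Averaging] Proposition 1 READ IN BOTH DIRECTIONS: the coarse plaquette
# deviation of the block average (42) is `L²` times ANY fine plaquette deviation of the averaging stencil, up to
# `L²`·(oscillation `ω` of the fine plaquette variables in the axial gauge) `+ 226·(8(d+1)(d+4)L²α₀)²`

Track A of `YM-PLAN.md` (cell `pub-ymgap`, HUMAN RULING D-0062), node **N21** of 28 (cluster K5 «SpineMatching», route
`Summit.QuantumFields.YangMills.Theses.BalabanUVNodes`, item `SpineGivenEndpoint`).  Seat `pub-ymgap-dag-n21-a` (KNIT-BY-NAME),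
generation 3, file 4 (files 1–3′: p408928, p409431, p410611, p411126).  `--supports stmt-QuantumFields-19182` (R432 (B)(2)).
Kernel bookkeeping, Mathlib + `B7Prop1Explicit` ∕ `B7AvgGaugeCovariance` only: 0 `def`, 0 `sorry`, standard axioms.  COUNT-NEUTRAL.
HONEST FRAMING.  [Balaban1985Averaging] Prop. 1 (51) p. 26 is the UPPER bound `|V̄(∂p′) − 1| ≤ L²α₀ + C₀(L²α₀)²` for the
average (42) of a configuration in the class (44) — in the tree with explicit constants (`B7Prop1Explicit.prop1_explicit`).
Bałaban needs and prints only this direction (one run is constructed).  The statements HERE are NOT PRINTED: they are the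
[folklore] observation that the printed proof (pp. 24–26: axial gauge (45), the four sides to second order (47)–(50), corner
cancellation + abelian Stokes (48)) is an EXPANSION `V̄(∂p′) − 1 = L^{−d}Σ_xΣ_{p⊂(p′)_x} A(∂p) + O((L²α₀)²)` whose main term is a
stencil average of `L²` abelianised fine plaquette variables; so if the fine plaquette variables `V₀(∂p)` IN THE AXIAL GAUGE are
within `ω` of a reference, `|V̄(∂p′) − 1|` is TWO-SIDEDLY comparable with `L²·|V(∂p₀) − 1|` up to `L²ω + 226θ²` (deviations are
gauge invariant).  Nothing of Bałaban's is asserted; the manuscript is cited for the SHAPE of the expansion only.  One lattice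
`ℤ^d`, one block average; NOT a statement about minimisers, NOT NE7c, NOT continuum ∕ OS ∕ mass gap ∕ Clay.

WHY (dag-ref-B READ #53 on p410611: «GAP-STATED … converse regularity transfer [LF-I] p. 193; run B's own fine test»).  File 3
compares run A's slot variables with those of `W = rescale L (bavg L U_B)` (run B's minimiser READ ON THE COMMON LATTICE) and
knits «run B small on its own FINE plaquettes ⇒ `W` small» through (51).  Run B's OWN test ([Balaban1988Convergent] (2.17))
reads the FINE plaquettes; the mismatch «run A small at `t`, run B NOT small at `t∕L²` on a fine plaquette» lies in a single-run
THRESHOLD SHELL only through the CONVERSE «fine deviation `≥ s` ⇒ coarse deviation `≥ L²s − L²ω − 226θ²`» (§4).  The companion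
`BalabanUVNodesN21AveragingOscillation` produces `ω` from a pointwise covariant one-step bound (the currency of the minimiser's
regularity, tree SHAPE `MinimalActionRefine.RegularSup`); the junction with N16's record decl is a third module.

CITATION HEADER (lean-in-tree rule 2026-08-18).  This seat read the tree's `B7Prop1Explicit` (whose seat read the renders of
journal pp. 17–26 of T. Bałaban, *Averaging operations for lattice gauge theories*, Commun. Math. Phys. **98** (1985) 17–51
[Balaban1985Averaging], cell paper B7, quoting (42), (44), (45), (47)–(51) verbatim) and re-uses its objects BY NAME: `hol`,
`plaqWord`, `gaugeAct`, `axialFn` (axial gauge, p. 24), `bavg` ((42)), `cplaq` ((44)), `boxVec`, `rectWord`, `asum`, `Tside`,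
`side_estimate` (p. 25), `norm_prod4_sub_one_sub_le` ((50)), `corner_cancellation` + `stokes` ((48)), `walk_linear`, `bond_log`,
`axial_bond_bound` (pp. 24–25), `prop1_core` (analyticity of the logarithms (47)), `bavg_gaugeAct` ∕ `cplaq_conj` ((45)).  Quoted
for SHAPE, p. 25 (as in `B7Prop1Explicit`): *"`|V̄₀,c − 1 − i Σ_{x∈B(c₋)} L^{−d} A(Γ_{c,x})| < O(1)(L²α₀)²`"* and (48)
*"`Σ_{c⊂∂p′} A(Γ_{c,x(c)}) = A(∂(p′)_x) = Σ_{p⊂(p′)_x} A(∂p)`"*.  No sentence of the manuscript is a hypothesis beyond those of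
`prop1_core` ∕ `prop1_explicit` ((44), `512(d+1)(d+4)L²α₀ ≤ 1`).
WHAT IS PROVED ([folklore]; `θ := 8(d+1)(d+4)L²α₀ ≤ 1∕64`).  §1 `norm_avg_sub_le` (weights `L^{−d}` = probability vector, (35)),
`norm_sum_sum_sub_le`.  §2 `main_term_sub_le`: the (48)–(49) main term is within `L²(ω + ρ(4a))` of `L²·(P₀ − 1)` for any
reference `P₀` within `ω` of all stencil plaquette variables (`walk_linear`).  §3 `prop1_core_twoSided` (axial gauge, bond
hypothesis of `prop1_core` verbatim): `‖(V̄₀(∂p′) − 1) − L²·(P₀ − 1)‖ ≤ L²ω + 226θ²`.  §4 `prop1_twoSided` (any configuration of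
the (44) class; reduction to the axial gauge at `y = z + Le_μ + Le_ν` by (45) as in `prop1_explicit`; oscillation hypothesis on
Bałaban's own `V₀ = V^{v₀}`): LOWER `L²‖V(∂p₀) − 1‖ ≤ ‖V̄(∂p′) − 1‖ + L²ω + 226θ²` and refined UPPER
`‖V̄(∂p′) − 1‖ ≤ L²‖V(∂p₀) − 1‖ + L²ω + 226θ²`; `abs_coarse_sub_fine_le` both at once; `fine_lt_of_coarse_lt` the threshold form.
-/

noncomputable section

open scoped BigOperators
open NormedSpace Finset

namespace Summit.QuantumFields.YangMills.Theorems.N21AveragingLower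

open Literature.MathematicalPhysics.QuantumFieldTheory.Balaban1983to89
open B7Prop1Explicit
open B7AvgGaugeCovariance (norm_conj_sub_one_eq)

variable {d : ℕ} {𝔸 : Type*} [NormedRing 𝔸] [NormOneClass 𝔸] [NormedAlgebra ℂ 𝔸] [CompleteSpace 𝔸]

/-! ## §1 Two averaging lemmas -/

omit [NormOneClass 𝔸] [CompleteSpace 𝔸] in
/-- `‖Σ_x L^{−d} f_x − g‖ ≤ sup_x ‖f_x − g‖`: the weights of (42) are a probability vector (cf. (35) p. 23;
`B7Prop1Explicit.norm_avg_le`). [cite: Balaban1985Averaging, (35) p.23] -/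
theorem norm_avg_sub_le (L : ℕ) (hL : 1 ≤ L) (f : (Fin d → Fin L) → 𝔸) (g : 𝔸) {K : ℝ}
    (hf : ∀ r, ‖f r - g‖ ≤ K) : ‖∑ r : Fin d → Fin L, ((L : ℝ) ^ d)⁻¹ • f r - g‖ ≤ K := by
  have h : ∑ r : Fin d → Fin L, ((L : ℝ) ^ d)⁻¹ • f r - g
      = ∑ r : Fin d → Fin L, ((L : ℝ) ^ d)⁻¹ • (f r - g) := by
    simp_rw [smul_sub, Finset.sum_sub_distrib, ← Finset.sum_smul, sum_weights L hL, one_smul]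
  rw [h]
  exact norm_avg_le L hL _ hf

omit [NormOneClass 𝔸] [CompleteSpace 𝔸] in
/-- An `L × L` double sum against `L²` copies of a reference term: `‖Σ_{i,j<L} a_{ij} − L²·b‖ ≤ L²·K` when every
`‖a_{ij} − b‖ ≤ K`. [folklore] -/
theorem norm_sum_sum_sub_le (L : ℕ) (a : ℕ → ℕ → 𝔸) (b : 𝔸) {K : ℝ}
    (h : ∀ i ∈ Finset.range L, ∀ j ∈ Finset.range L, ‖a i j - b‖ ≤ K) :
    ‖∑ i ∈ Finset.range L, ∑ j ∈ Finset.range L, a i j - ((L : ℝ) ^ 2) • b‖ ≤ (L : ℝ) ^ 2 * K := by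
  have e : ∑ i ∈ Finset.range L, ∑ j ∈ Finset.range L, (a i j - b)
      = ∑ i ∈ Finset.range L, ∑ j ∈ Finset.range L, a i j - ((L : ℝ) ^ 2) • b := by
    simp only [Finset.sum_sub_distrib, Finset.sum_const, Finset.card_range]
    rw [← Nat.cast_smul_eq_nsmul ℝ L b, ← Nat.cast_smul_eq_nsmul ℝ L, smul_smul, ← sq]
  rw [← e]
  calc ‖∑ i ∈ Finset.range L, ∑ j ∈ Finset.range L, (a i j - b)‖
      ≤ ∑ i ∈ Finset.range L, ‖∑ j ∈ Finset.range L, (a i j - b)‖ := norm_sum_le _ _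
    _ ≤ ∑ i ∈ Finset.range L, ∑ j ∈ Finset.range L, ‖a i j - b‖ :=
        Finset.sum_le_sum fun i _ => norm_sum_le _ _
    _ ≤ ∑ i ∈ Finset.range L, ∑ j ∈ Finset.range L, K :=
        Finset.sum_le_sum fun i hi => Finset.sum_le_sum fun j hj => h i hi j hj
    _ = (L : ℝ) ^ 2 * K := by
        rw [Finset.sum_const, Finset.sum_const, Finset.card_range, nsmul_eq_mul, nsmul_eq_mul]; ring

/-! ## §2 The main term of (48)–(49) against `L²` times a reference plaquette -/

omit [NormOneClass 𝔸] in
/-- **The (48)–(49) main term, two-sided.**  In the region where `V₀(b) = e^{A_b}`, `‖A_b‖ ≤ a` (`walk_linear`), the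
stencil average `L^{−d}Σ_x A(∂(p′)_x) = L^{−d}Σ_x Σ_{p⊂(p′)_x} A(∂p)` (`stokes`) is within `L²·(ω + ρ(4a))` of `L²·(P₀ − 1)`
whenever every fine plaquette variable `V₀(∂p)`, `p ⊂ (p′)_x`, `x ∈ B(y₀)`, is within `ω` of the reference `P₀`
(`ρ(t) = e^t − 1 − t` bounds `‖V₀(∂p) − 1 − A(∂p)‖`). [folklore] -/
theorem main_term_sub_le (V₀ : B7Prop1Explicit.Site d → Fin d → 𝔸ˣ) (A : B7Prop1Explicit.Site d → Fin d → 𝔸) (y : B7Prop1Explicit.Site d) (R : ℕ) {a : ℝ}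
    (ha : 0 ≤ a) (hVA : ∀ x κ, l1 (x - y) ≤ R → ((V₀ x κ : 𝔸ˣ) : 𝔸) = exp (A x κ) ∧ ‖A x κ‖ ≤ a)
    (L : ℕ) (hL : 1 ≤ L) (z : B7Prop1Explicit.Site d) (μ ν : Fin d)
    (hR : ∀ (r : Fin d → Fin L) (i j : ℕ), i < L → j < L →
      l1 (z + boxVec L r + (i : ℤ) • e μ + (j : ℤ) • e ν - y) + 4 ≤ R)
    (P₀ : 𝔸) {ω : ℝ}
    (hosc : ∀ (r : Fin d → Fin L) (i j : ℕ), i < L → j < L →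
      ‖((hol V₀ (z + boxVec L r + (i : ℤ) • e μ + (j : ℤ) • e ν) (plaqWord μ ν) : 𝔸ˣ) : 𝔸) - P₀‖ ≤ ω) :
    ‖∑ r : Fin d → Fin L, ((L : ℝ) ^ d)⁻¹ • asum A (z + boxVec L r) (rectWord L L μ ν)
        - ((L : ℝ) ^ 2) • (P₀ - 1)‖ ≤ (L : ℝ) ^ 2 * (ω + expRem (4 * a)) := by
  refine norm_avg_sub_le L hL _ _ fun r => ?_
  rw [stokes]
  have hp : ∀ i ∈ Finset.range L, ∀ j ∈ Finset.range L,
      ‖asum A (z + boxVec L r + (i : ℤ) • e μ + (j : ℤ) • e ν) (plaqWord μ ν) - (P₀ - 1)‖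
        ≤ ω + expRem (4 * a) := by
    intro i hi j hj
    rw [Finset.mem_range] at hi hj
    obtain ⟨-, h2⟩ := walk_linear V₀ A y R ha hVA (plaqWord μ ν) _ (hR r i j hi hj)
    have hl : ((plaqWord μ ν : List (Letter d)).length : ℝ) = 4 := by simp [plaqWord]
    rw [hl] at h2
    have h3 := hosc r i j hi hj
    calc ‖asum A (z + boxVec L r + (i : ℤ) • e μ + (j : ℤ) • e ν) (plaqWord μ ν) - (P₀ - 1)‖
        = ‖(((hol V₀ (z + boxVec L r + (i : ℤ) • e μ + (j : ℤ) • e ν) (plaqWord μ ν) : 𝔸ˣ) : 𝔸) - P₀)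
            - (((hol V₀ (z + boxVec L r + (i : ℤ) • e μ + (j : ℤ) • e ν) (plaqWord μ ν) : 𝔸ˣ) : 𝔸) - 1
              - asum A (z + boxVec L r + (i : ℤ) • e μ + (j : ℤ) • e ν) (plaqWord μ ν))‖ := by
          congr 1; abel
      _ ≤ _ := norm_sub_le _ _
      _ ≤ ω + expRem (4 * a) := add_le_add h3 h2
  exact norm_sum_sum_sub_le L _ _ hp

/-! ## §3 Proposition 1 TWO-SIDED in the axial gauge: the expansion (45)–(50) against `L²·(V₀(∂p₀) − 1)` -/

omit [NormOneClass 𝔸] in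
/-- **Proposition 1, two-sided core** (axial gauge; the bond hypothesis of `B7Prop1Explicit.prop1_core` VERBATIM —
`|V₀(b) − 1| ≤ |b₋ − y|₁α₀` near `y`, `512(d+1)(d+4)L²α₀ ≤ 1` — plus a reference `P₀` and an oscillation bound `ω`:
every fine plaquette variable `V₀(∂p)` of the stencil `p ⊂ (p′)_x`, `x ∈ B(z)`, is within `ω` of `P₀`): with
`θ := 8(d+1)(d+4)L²α₀ (≤ 1∕64)`, `‖(V̄₀(∂p′) − 1) − L²·(P₀ − 1)‖ ≤ L²ω + 226θ²`.  Proof = the printed expansion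
pp. 24–26 of `prop1_core` (four sides to second order (47)∕(50) by `side_estimate` + `norm_prod4_sub_one_sub_le`;
first-order terms = the stencil average of `A(∂(p′)_x)` by `corner_cancellation`), with the main term compared to
`L²·(P₀ − 1)` by §2 instead of bounded by (49) — so (44) itself is not even needed here, only its consequence on the
bonds of the axial gauge.  NOT PRINTED as a statement ([Balaban1985Averaging] proves the upper bound (51) only);
SHAPE of pp. 24–26. [cite: Balaban1985Averaging, Prop. 1 (44)–(51) pp.24–26] -/
theorem prop1_core_twoSided (L : ℕ) (hL : 1 ≤ L) (z y : B7Prop1Explicit.Site d) {μ ν : Fin d}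
    (hy : y = z + (L : ℤ) • e μ + (L : ℤ) • e ν) (V₀ : B7Prop1Explicit.Site d → Fin d → 𝔸ˣ) {α₀ : ℝ} (hα₀ : 0 ≤ α₀)
    (hsmall : 512 * (d + 1) * (d + 4) * (L : ℝ) ^ 2 * α₀ ≤ 1)
    (hbond : ∀ x κ, l1 (x - y) ≤ (2 * d + 4) * L + 4 → ‖((V₀ x κ : 𝔸ˣ) : 𝔸) - 1‖ ≤ l1 (x - y) * α₀)
    (P₀ : 𝔸) {ω : ℝ}
    (hosc : ∀ (r : Fin d → Fin L) (i j : ℕ), i < L → j < L →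
      ‖((hol V₀ (z + boxVec L r + (i : ℤ) • e μ + (j : ℤ) • e ν) (plaqWord μ ν) : 𝔸ˣ) : 𝔸) - P₀‖ ≤ ω) :
    ‖(((cplaq L (bavg L V₀) z μ ν : 𝔸ˣ) : 𝔸) - 1) - ((L : ℝ) ^ 2) • (P₀ - 1)‖
      ≤ (L : ℝ) ^ 2 * ω + 226 * (8 * (d + 1) * (d + 4) * (L : ℝ) ^ 2 * α₀) ^ 2 := by
  have hd : 1 ≤ d := μ.pos
  -- the constants (as in `prop1_core`)
  set R : ℕ := (2 * d + 4) * L + 4 with hRdef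
  set a : ℝ := 4 * (d + 4) * L * α₀ with hadef
  set θ : ℝ := 8 * (d + 1) * (d + 4) * (L : ℝ) ^ 2 * α₀ with hθdef
  have hLr : (1 : ℝ) ≤ L := by exact_mod_cast hL
  have hdr : (1 : ℝ) ≤ d := by exact_mod_cast hd
  have ha : 0 ≤ a := by positivity
  have hθ0 : 0 ≤ θ := by positivity
  have hθ1 : θ ≤ 1 / 64 := by
    have : 64 * θ = 512 * (d + 1) * (d + 4) * (L : ℝ) ^ 2 * α₀ := by rw [hθdef]; ring
    linarith
  have haθ : 4 * a ≤ θ := by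
    have e1 : θ - 4 * a = 8 * ((d : ℝ) + 4) * L * α₀ * ((d + 1) * L - 2) := by rw [hθdef, hadef]; ring
    have e2 : 0 ≤ 8 * ((d : ℝ) + 4) * L * α₀ * ((d + 1) * L - 2) :=
      mul_nonneg (by positivity) (by nlinarith [mul_nonneg (sub_nonneg.mpr hdr) (by positivity : (0 : ℝ) ≤ L)])
    linarith
  have ha1 : a ≤ 1 := by linarith
  have hRa : ((R : ℕ) : ℝ) * α₀ ≤ a / 2 := by
    have e1 : a / 2 - ((R : ℕ) : ℝ) * α₀ = 4 * ((L : ℝ) - 1) * α₀ := by rw [hRdef, hadef]; push_cast; ring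
    have e2 : 0 ≤ 4 * ((L : ℝ) - 1) * α₀ := mul_nonneg (mul_nonneg (by norm_num) (by linarith)) hα₀
    linarith
  -- the bond field `A = log V₀` in the region of control
  have hb : ∀ x κ, l1 (x - y) ≤ R → ‖((V₀ x κ : 𝔸ˣ) : 𝔸) - 1‖ ≤ a / 2 := fun x κ hx =>
    (hbond x κ hx).trans ((mul_le_mul_of_nonneg_right (by exact_mod_cast hx) hα₀).trans hRa)
  have hVA := bond_log y R ha1 hb
  set A : B7Prop1Explicit.Site d → Fin d → 𝔸 := fun x κ => MatrixLog.mlog ((V₀ x κ : 𝔸ˣ) : 𝔸) with hAdef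
  -- the four sides (47)/(50)
  have hθN : ((2 * (d * L) + L + L : ℕ) : ℝ) * a ≤ θ := le_of_eq (by rw [hadef, hθdef]; push_cast; ring)
  have hRexp : R = 2 * (d * L) + 4 * L + 4 := by rw [hRdef]; ring
  have hzy : l1 (z - y) ≤ 2 * L := by
    rw [hy, show z - (z + (L : ℤ) • e μ + (L : ℤ) • e ν) = -((L : ℤ) • e μ + (L : ℤ) • e ν) by abel, l1_neg]
    refine (l1_add_le _ _).trans ?_
    rw [l1_zsmul_e, l1_zsmul_e, Int.natAbs_natCast]; omega
  have hzμy : l1 (z + (L : ℤ) • e μ - y) ≤ 2 * L := by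
    rw [hy, show z + (L : ℤ) • e μ - (z + (L : ℤ) • e μ + (L : ℤ) • e ν) = -((L : ℤ) • e ν) by abel, l1_neg,
      l1_zsmul_e, Int.natAbs_natCast]; omega
  have hzνy : l1 (z + (L : ℤ) • e ν - y) ≤ 2 * L := by
    rw [hy, show z + (L : ℤ) • e ν - (z + (L : ℤ) • e μ + (L : ℤ) • e ν) = -((L : ℤ) • e μ) by abel, l1_neg,
      l1_zsmul_e, Int.natAbs_natCast]; omega
  have hside : ∀ q κ, l1 (q - y) ≤ 2 * L →
      ‖((bavg L V₀ q κ : 𝔸ˣ) : 𝔸) - 1‖ ≤ 2 * θ ∧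
      ‖((bavg L V₀ q κ : 𝔸ˣ) : 𝔸) - 1 - Tside L A q κ‖ ≤ 50 * θ ^ 2 ∧
      ‖(((bavg L V₀ q κ)⁻¹ : 𝔸ˣ) : 𝔸) - 1‖ ≤ 2 * θ ∧
      ‖(((bavg L V₀ q κ)⁻¹ : 𝔸ˣ) : 𝔸) - 1 - (-Tside L A q κ)‖ ≤ 50 * θ ^ 2 ∧
      ∀ r : Fin d → Fin L, ‖((Wcx L V₀ q κ (boxVec L r) : 𝔸ˣ) : 𝔸) - 1‖ ≤ 2 * θ := fun q κ hq =>
    side_estimate V₀ A y R ha hVA L hL q κ (by rw [hRexp]; omega) hθN hθ0 hθ1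
  obtain ⟨f1, e1, -, -, -⟩ := hside z μ hzy
  obtain ⟨f2, e2, -, -, -⟩ := hside (z + (L : ℤ) • e μ) ν hzμy
  obtain ⟨-, -, f3, e3, -⟩ := hside (z + (L : ℤ) • e ν) μ hzνy
  obtain ⟨-, -, f4, e4, -⟩ := hside z ν hzy
  have hP := norm_prod4_sub_one_sub_le (by positivity) f1 f2 f3 f4 e1 e2 e3 e4
  -- (48): the first-order terms add up to the stencil average of `A(∂(p′)_x)`
  have hTsum : Tside L A z μ + Tside L A (z + (L : ℤ) • e μ) ν + -Tside L A (z + (L : ℤ) • e ν) μ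
      + -Tside L A z ν = ∑ r : Fin d → Fin L, ((L : ℝ) ^ d)⁻¹ • asum A (z + boxVec L r) (rectWord L L μ ν) := by
    simp only [Tside, ← Finset.sum_neg_distrib, ← Finset.sum_add_distrib, ← smul_neg, ← smul_add]
    refine Finset.sum_congr rfl fun r _ => ?_
    rw [← corner_cancellation]
    congr 1
    abel
  -- the main term against `L²·(P₀ − 1)` (§2)
  have hmain := main_term_sub_le V₀ A y R ha hVA L hL z μ ν (fun r i j hi hj => by
    have h1 := l1_add_le (z - y) (boxVec L r + (i : ℤ) • e μ + (j : ℤ) • e ν)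
    have h2 := (l1_add_le (boxVec L r + (i : ℤ) • e μ) ((j : ℤ) • e ν))
    have h3 := (l1_add_le (boxVec L r) ((i : ℤ) • e μ))
    have h4 := l1_boxVec_le L r
    rw [l1_zsmul_e, Int.natAbs_natCast] at h2 h3
    rw [show z - y + (boxVec L r + (i : ℤ) • e μ + (j : ℤ) • e ν)
      = z + boxVec L r + (i : ℤ) • e μ + (j : ℤ) • e ν - y by abel] at h1
    rw [hRexp]; omega) P₀ hosc
  have hρ : (L : ℝ) ^ 2 * (ω + expRem (4 * a)) ≤ (L : ℝ) ^ 2 * ω + θ ^ 2 := by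
    have h1 : expRem (4 * a) ≤ (4 * a) ^ 2 := expRem_le_sq (by positivity) (by linarith)
    have h2 : θ ^ 2 - (L : ℝ) ^ 2 * (4 * a) ^ 2 = 64 * ((d + 4) * (L : ℝ) ^ 2 * α₀) ^ 2 * ((d + 1) ^ 2 - 4) := by
      rw [hθdef, hadef]; ring
    have h3 : 0 ≤ 64 * ((d + 4) * (L : ℝ) ^ 2 * α₀) ^ 2 * (((d : ℝ) + 1) ^ 2 - 4) :=
      mul_nonneg (by positivity) (by nlinarith)
    have h4 := mul_le_mul_of_nonneg_left h1 (by positivity : (0 : ℝ) ≤ (L : ℝ) ^ 2)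
    rw [mul_add]
    linarith
  -- (50): collecting terms
  have hθ3 : θ ^ 3 ≤ θ ^ 2 / 64 := by
    calc θ ^ 3 = θ ^ 2 * θ := by ring
      _ ≤ θ ^ 2 * (1 / 64) := by gcongr
      _ = θ ^ 2 / 64 := by ring
  have hθ4 : θ ^ 4 ≤ θ ^ 2 / 64 := by
    calc θ ^ 4 = θ ^ 2 * (θ * θ) := by ring
      _ ≤ θ ^ 2 * (1 / 64 * 1) := by gcongr; linarith
      _ = θ ^ 2 / 64 := by ring
  have hcp : ((cplaq L (bavg L V₀) z μ ν : 𝔸ˣ) : 𝔸) = ((bavg L V₀ z μ : 𝔸ˣ) : 𝔸)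
      * ((bavg L V₀ (z + (L : ℤ) • e μ) ν : 𝔸ˣ) : 𝔸) * (((bavg L V₀ (z + (L : ℤ) • e ν) μ)⁻¹ : 𝔸ˣ) : 𝔸)
      * (((bavg L V₀ z ν)⁻¹ : 𝔸ˣ) : 𝔸) := by simp only [cplaq, Units.val_mul]
  rw [hcp]
  rw [hTsum] at hP
  calc _ = ‖(_ - 1 - ∑ r : Fin d → Fin L, ((L : ℝ) ^ d)⁻¹ • asum A (z + boxVec L r) (rectWord L L μ ν))
          + (∑ r : Fin d → Fin L, ((L : ℝ) ^ d)⁻¹ • asum A (z + boxVec L r) (rectWord L L μ ν)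
            - ((L : ℝ) ^ 2) • (P₀ - 1))‖ := by
          rw [sub_add_sub_cancel]
    _ ≤ _ := norm_add_le _ _
    _ ≤ (4 * (50 * θ ^ 2) + (2 * θ) ^ 2 * (6 + 4 * (2 * θ) + (2 * θ) ^ 2))
          + (L : ℝ) ^ 2 * (ω + expRem (4 * a)) := add_le_add hP hmain
    _ ≤ (L : ℝ) ^ 2 * ω + 226 * θ ^ 2 := by linarith [sq_nonneg θ]

/-! ## §4 Proposition 1 TWO-SIDED for a configuration in the (44) class: reduction to the axial gauge by (45) -/

omit [NormOneClass 𝔸] [CompleteSpace 𝔸] in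
/-- `‖c • X‖ = c‖X‖` for a real `c ≥ 0`. [folklore] -/
theorem norm_smul_of_nonneg {c : ℝ} (hc : 0 ≤ c) (X : 𝔸) : ‖c • X‖ = c * ‖X‖ := by
  rw [norm_smul, Real.norm_of_nonneg hc]

/-- **Proposition 1, TWO-SIDED, for an arbitrary configuration of the (44) class.**  Let `V` on `ℤ^d` take values in
`{|u| ≤ 1, |u⁻¹| ≤ 1}` and satisfy (44) `|V(∂p) − 1| ≤ α₀` for all unit plaquettes, `512(d+1)(d+4)L²α₀ ≤ 1`; let `p′`
be the plaquette of the `L`-lattice with corner `z` in the plane `μν`, `y = z + Le_μ + Le_ν`, `V₀ = V^{v₀}` the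
configuration in the AXIAL GAUGE of p. 24 (`v₀ = axialFn V y`), `p₀ = (x₀; μν)` ANY reference plaquette (a stencil
plaquette in every use), and suppose the axial-gauge plaquette variables of the averaging stencil are within `ω` of
that of `p₀`: `‖V₀(∂p) − V₀(∂p₀)‖ ≤ ω`, `p ⊂ (p′)_x`, `x ∈ B(z)`.  Then with `θ = 8(d+1)(d+4)L²α₀`:
(lower) `L²·|V(∂p₀) − 1| ≤ |V̄(∂p′) − 1| + L²ω + 226θ²`, and (upper) `|V̄(∂p′) − 1| ≤ L²·|V(∂p₀) − 1| + L²ω + 226θ²`.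
The reduction to §3 is (45) exactly as in `prop1_explicit` (`axial_bond_bound`, `prop1_core` for the analyticity
radius of the logarithms, `bavg_gaugeAct`, `cplaq_conj`), and the deviations of `V₀` are those of `V` (gauge
invariance).  NOT PRINTED (print: the upper bound (51) with `sup` in place of `p₀` and no `ω`). [cite: Balaban1985Averaging, Prop. 1 (44)–(51) pp.24–26] -/
theorem prop1_twoSided (L : ℕ) (hL : 1 ≤ L) (z : B7Prop1Explicit.Site d) {μ ν : Fin d} (hμν : μ ≠ ν)
    (V : B7Prop1Explicit.Site d → Fin d → 𝔸ˣ) (hV : ∀ x κ, V x κ ∈ U1 𝔸) {α₀ : ℝ} (hα₀ : 0 ≤ α₀)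
    (hsmall : 512 * (d + 1) * (d + 4) * (L : ℝ) ^ 2 * α₀ ≤ 1)
    (h44 : ∀ (x : B7Prop1Explicit.Site d) (κ κ' : Fin d), κ ≠ κ' → ‖((hol V x (plaqWord κ κ') : 𝔸ˣ) : 𝔸) - 1‖ ≤ α₀)
    (x₀ : B7Prop1Explicit.Site d) {ω : ℝ}
    (hosc : ∀ (r : Fin d → Fin L) (i j : ℕ), i < L → j < L →
      ‖((hol (gaugeAct (axialFn V (z + (L : ℤ) • e μ + (L : ℤ) • e ν)) V)
            (z + boxVec L r + (i : ℤ) • e μ + (j : ℤ) • e ν) (plaqWord μ ν) : 𝔸ˣ) : 𝔸)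
        - ((hol (gaugeAct (axialFn V (z + (L : ℤ) • e μ + (L : ℤ) • e ν)) V) x₀ (plaqWord μ ν) : 𝔸ˣ) : 𝔸)‖
          ≤ ω) :
    (L : ℝ) ^ 2 * ‖((hol V x₀ (plaqWord μ ν) : 𝔸ˣ) : 𝔸) - 1‖
        ≤ ‖((cplaq L (bavg L V) z μ ν : 𝔸ˣ) : 𝔸) - 1‖
          + ((L : ℝ) ^ 2 * ω + 226 * (8 * (d + 1) * (d + 4) * (L : ℝ) ^ 2 * α₀) ^ 2) ∧
      ‖((cplaq L (bavg L V) z μ ν : 𝔸ˣ) : 𝔸) - 1‖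
        ≤ (L : ℝ) ^ 2 * ‖((hol V x₀ (plaqWord μ ν) : 𝔸ˣ) : 𝔸) - 1‖
          + ((L : ℝ) ^ 2 * ω + 226 * (8 * (d + 1) * (d + 4) * (L : ℝ) ^ 2 * α₀) ^ 2) := by
  set y : B7Prop1Explicit.Site d := z + (L : ℤ) • e μ + (L : ℤ) • e ν with hy
  set u : B7Prop1Explicit.Site d → 𝔸ˣ := axialFn V y with hu
  set V₀ : B7Prop1Explicit.Site d → Fin d → 𝔸ˣ := gaugeAct u V with hV₀
  have huU : ∀ x, u x ∈ U1 𝔸 := fun x => axialFn_mem hV y x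
  have h44₀ : ∀ x, ‖((hol V₀ x (plaqWord μ ν) : 𝔸ˣ) : 𝔸) - 1‖ ≤ α₀ := fun x => by
    rw [hV₀, hol_gaugeAct_closed _ _ _ _ (disp_plaqWord μ ν), Units.val_mul, Units.val_mul]
    exact (norm_units_conj_sub_one_le (huU x) _).trans (h44 x μ ν hμν)
  have hbond : ∀ x κ, l1 (x - y) ≤ (2 * d + 4) * L + 4 → ‖((V₀ x κ : 𝔸ˣ) : 𝔸) - 1‖ ≤ l1 (x - y) * α₀ :=
    fun x κ _ => axial_bond_bound V hV y h44 hα₀ x κ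
  -- §3 in the axial gauge
  have hM := prop1_core_twoSided L hL z y hy V₀ hα₀ hsmall hbond
    ((hol V₀ x₀ (plaqWord μ ν) : 𝔸ˣ) : 𝔸) hosc
  -- (45): the deviations of `V₀` and of its average are those of `V`
  obtain ⟨-, hW⟩ := prop1_core L hL z y hy V₀ hα₀ hsmall h44₀ hbond
  have hzy : l1 (z - y) ≤ 2 * L := by
    rw [hy, show z - (z + (L : ℤ) • e μ + (L : ℤ) • e ν) = -((L : ℤ) • e μ + (L : ℤ) • e ν) by abel, l1_neg]
    refine (l1_add_le _ _).trans ?_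
    rw [l1_zsmul_e, l1_zsmul_e, Int.natAbs_natCast]; omega
  have hzμy : l1 (z + (L : ℤ) • e μ - y) ≤ 2 * L := by
    rw [hy, show z + (L : ℤ) • e μ - (z + (L : ℤ) • e μ + (L : ℤ) • e ν) = -((L : ℤ) • e ν) by abel, l1_neg,
      l1_zsmul_e, Int.natAbs_natCast]; omega
  have hzνy : l1 (z + (L : ℤ) • e ν - y) ≤ 2 * L := by
    rw [hy, show z + (L : ℤ) • e ν - (z + (L : ℤ) • e μ + (L : ℤ) • e ν) = -((L : ℤ) • e μ) by abel, l1_neg,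
      l1_zsmul_e, Int.natAbs_natCast]; omega
  have hcov : ∀ q κ, l1 (q - y) ≤ 2 * L → bavg L V₀ q κ = u q * bavg L V q κ * (u (q + (L : ℤ) • e κ))⁻¹ := by
    intro q κ hq
    rw [hV₀]
    refine bavg_gaugeAct L huU V q κ fun r => ?_
    refine (norm_sub_one_le_of_conj (X := Wcx L V q κ (boxVec L r)) (huU q)).trans_lt ?_
    rw [← Wcx_gaugeAct]
    exact hW q κ hq r
  have hconj := cplaq_conj L u (bavg L V) (bavg L V₀) z μ ν (hcov z μ hzy) (hcov _ ν hzμy) (hcov _ μ hzνy)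
    (hcov z ν hzy)
  have hcdev : ‖((cplaq L (bavg L V₀) z μ ν : 𝔸ˣ) : 𝔸) - 1‖ = ‖((cplaq L (bavg L V) z μ ν : 𝔸ˣ) : 𝔸) - 1‖ := by
    rw [hconj]; exact norm_conj_sub_one_eq (huU z)
  have hpdev : ‖((hol V₀ x₀ (plaqWord μ ν) : 𝔸ˣ) : 𝔸) - 1‖ = ‖((hol V x₀ (plaqWord μ ν) : 𝔸ˣ) : 𝔸) - 1‖ := by
    rw [hV₀, hol_gaugeAct_closed _ _ _ _ (disp_plaqWord μ ν)]
    exact norm_conj_sub_one_eq (huU x₀)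
  have hL2 : (0 : ℝ) ≤ (L : ℝ) ^ 2 := by positivity
  have hns : ‖((L : ℝ) ^ 2) • (((hol V₀ x₀ (plaqWord μ ν) : 𝔸ˣ) : 𝔸) - 1)‖
      = (L : ℝ) ^ 2 * ‖((hol V x₀ (plaqWord μ ν) : 𝔸ˣ) : 𝔸) - 1‖ := by
    rw [norm_smul_of_nonneg hL2, hpdev]
  refine ⟨?_, ?_⟩
  · rw [← hns, ← hcdev]
    calc _ = ‖(((cplaq L (bavg L V₀) z μ ν : 𝔸ˣ) : 𝔸) - 1)
            - ((((cplaq L (bavg L V₀) z μ ν : 𝔸ˣ) : 𝔸) - 1)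
              - ((L : ℝ) ^ 2) • (((hol V₀ x₀ (plaqWord μ ν) : 𝔸ˣ) : 𝔸) - 1))‖ := by rw [sub_sub_cancel]
      _ ≤ _ := norm_sub_le _ _
      _ ≤ _ := add_le_add le_rfl hM
  · rw [← hns, ← hcdev]
    calc _ = ‖((((cplaq L (bavg L V₀) z μ ν : 𝔸ˣ) : 𝔸) - 1)
              - ((L : ℝ) ^ 2) • (((hol V₀ x₀ (plaqWord μ ν) : 𝔸ˣ) : 𝔸) - 1))
            + ((L : ℝ) ^ 2) • (((hol V₀ x₀ (plaqWord μ ν) : 𝔸ˣ) : 𝔸) - 1)‖ := by rw [sub_add_cancel]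
      _ ≤ _ := norm_add_le _ _
      _ ≤ _ := by linarith [hM]

/-- **The two-sided comparison as one absolute value**: `|‖V̄(∂p′) − 1‖ − L²·‖V(∂p₀) − 1‖| ≤ L²ω + 226θ²` for every
stencil plaquette `p₀`, under the hypotheses of `prop1_twoSided`. [folklore] -/
theorem abs_coarse_sub_fine_le (L : ℕ) (hL : 1 ≤ L) (z : B7Prop1Explicit.Site d) {μ ν : Fin d} (hμν : μ ≠ ν)
    (V : B7Prop1Explicit.Site d → Fin d → 𝔸ˣ) (hV : ∀ x κ, V x κ ∈ U1 𝔸) {α₀ : ℝ} (hα₀ : 0 ≤ α₀)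
    (hsmall : 512 * (d + 1) * (d + 4) * (L : ℝ) ^ 2 * α₀ ≤ 1)
    (h44 : ∀ (x : B7Prop1Explicit.Site d) (κ κ' : Fin d), κ ≠ κ' → ‖((hol V x (plaqWord κ κ') : 𝔸ˣ) : 𝔸) - 1‖ ≤ α₀)
    (x₀ : B7Prop1Explicit.Site d) {ω : ℝ}
    (hosc : ∀ (r : Fin d → Fin L) (i j : ℕ), i < L → j < L →
      ‖((hol (gaugeAct (axialFn V (z + (L : ℤ) • e μ + (L : ℤ) • e ν)) V)
            (z + boxVec L r + (i : ℤ) • e μ + (j : ℤ) • e ν) (plaqWord μ ν) : 𝔸ˣ) : 𝔸)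
        - ((hol (gaugeAct (axialFn V (z + (L : ℤ) • e μ + (L : ℤ) • e ν)) V) x₀ (plaqWord μ ν) : 𝔸ˣ) : 𝔸)‖
          ≤ ω) :
    |‖((cplaq L (bavg L V) z μ ν : 𝔸ˣ) : 𝔸) - 1‖
        - (L : ℝ) ^ 2 * ‖((hol V x₀ (plaqWord μ ν) : 𝔸ˣ) : 𝔸) - 1‖|
      ≤ (L : ℝ) ^ 2 * ω + 226 * (8 * (d + 1) * (d + 4) * (L : ℝ) ^ 2 * α₀) ^ 2 := by
  obtain ⟨h1, h2⟩ := prop1_twoSided L hL z hμν V hV hα₀ hsmall h44 x₀ hosc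
  rw [abs_sub_le_iff]
  constructor <;> linarith

/-- **THRESHOLD FORM (what the N21 junction consumes).**  If the coarse plaquette deviation of the average is `< t`
then EVERY fine plaquette of the averaging stencil has deviation `< (t + L²ω + 226θ²)∕L²` — «`W` small at `t` ⇒ the
configuration small on the fine plaquettes of the stencil at the `L²`-rescaled threshold, up to the oscillation and
the second-order error»; contrapositively «a fine plaquette NOT small ⇒ `W` NOT small at the lowered threshold». [folklore] -/
theorem fine_lt_of_coarse_lt (L : ℕ) (hL : 1 ≤ L) (z : B7Prop1Explicit.Site d) {μ ν : Fin d} (hμν : μ ≠ ν)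
    (V : B7Prop1Explicit.Site d → Fin d → 𝔸ˣ) (hV : ∀ x κ, V x κ ∈ U1 𝔸) {α₀ : ℝ} (hα₀ : 0 ≤ α₀)
    (hsmall : 512 * (d + 1) * (d + 4) * (L : ℝ) ^ 2 * α₀ ≤ 1)
    (h44 : ∀ (x : B7Prop1Explicit.Site d) (κ κ' : Fin d), κ ≠ κ' → ‖((hol V x (plaqWord κ κ') : 𝔸ˣ) : 𝔸) - 1‖ ≤ α₀)
    (x₀ : B7Prop1Explicit.Site d) {ω : ℝ}
    (hosc : ∀ (r : Fin d → Fin L) (i j : ℕ), i < L → j < L →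
      ‖((hol (gaugeAct (axialFn V (z + (L : ℤ) • e μ + (L : ℤ) • e ν)) V)
            (z + boxVec L r + (i : ℤ) • e μ + (j : ℤ) • e ν) (plaqWord μ ν) : 𝔸ˣ) : 𝔸)
        - ((hol (gaugeAct (axialFn V (z + (L : ℤ) • e μ + (L : ℤ) • e ν)) V) x₀ (plaqWord μ ν) : 𝔸ˣ) : 𝔸)‖
          ≤ ω)
    {t : ℝ} (ht : ‖((cplaq L (bavg L V) z μ ν : 𝔸ˣ) : 𝔸) - 1‖ < t) :
    ‖((hol V x₀ (plaqWord μ ν) : 𝔸ˣ) : 𝔸) - 1‖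
      < (t + ((L : ℝ) ^ 2 * ω + 226 * (8 * (d + 1) * (d + 4) * (L : ℝ) ^ 2 * α₀) ^ 2)) / (L : ℝ) ^ 2 := by
  obtain ⟨h1, -⟩ := prop1_twoSided L hL z hμν V hV hα₀ hsmall h44 x₀ hosc
  have hL2 : (0 : ℝ) < (L : ℝ) ^ 2 := by
    have : (1 : ℝ) ≤ L := by exact_mod_cast hL
    positivity
  rw [lt_div_iff₀ hL2, mul_comm]
  linarith

end Summit.QuantumFields.YangMills.Theorems.N21AveragingLower

end
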